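import Mathlib.RepresentationTheory.Semisimple
import Mathlib.RepresentationTheory.Basic
import Mathlib.LinearAlgebra.Projection
import Mathlib.GroupTheory.Index
import Literature.RepresentationTheory.Semisimple.CliffordRestriction
import HarnessLib

/-!
# Relative Maschke theorem: semisimplicity ascends from a normal subgroup of invertible index

Topic `Literature/RepresentationTheory/Semisimple`.  Everything in this file is PROVED (theorems
only; no definition, no named fact).

Let `k` be a field, `H` a group, `N ◁ H` a normal subgroup of finite index `n = [H : N]` with `n`
invertible in `k`, and `ρ : H → GL(V)` a representation on a `k`-vector space `V` (no
finite-dimensionality needed).  **Relative Maschke theorem**: if an `H`-subrepresentation `W ≤ V`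
has an `N`-stable complement, then it has an `H`-stable complement; hence if `ρ|_N` is semisimple
(every `N`-subrepresentation has a complement), so is `ρ`.  Proof (Maschke's averaging over the
finite group `H/N`, as in Kurdachenko–Otal–Subbotin, *Artinian Modules over Group Rings* (2007),
Ch. 5, proof of Thm. 5.9): the projection `π` onto `W` along an `N`-stable complement is
`N`-equivariant, so its conjugate `ρ(a) π ρ(a)⁻¹` depends only on the coset `aN`; the average
`π̃ = n⁻¹ Σ_{aN ∈ H/N} ρ(a) π ρ(a)⁻¹` is an `H`-equivariant projection onto `W`, and `ker π̃` is the
sought complement.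

Combined with Clifford's theorem (`CliffordRestriction.lean`: restriction of a finite-dimensional
semisimple representation to a normal subgroup is semisimple) this gives the **restriction of a
finite-dimensional semisimple representation to ANY subgroup of finite index is semisimple** in
characteristic `0` (pass through the normal core `N = ⋂ gSg⁻¹ ◁ G`, of finite index, `N ≤ S`:
`ρ|_N` is semisimple by Clifford, hence `ρ|_S` by the relative Maschke theorem for `N ◁ S`).

* `Subrepresentation.isCompl_iff_toSubmodule` — complements of subrepresentations are computed on
  the underlying submodules.
* `Representation.exists_isCompl_of_exists_isCompl_restrictSubgroup` — relative Maschke for one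
  subrepresentation (KOS Thm. 5.9 over a field with `[H:N]` invertible).
* `Representation.isSemisimpleRepresentation_of_restrictSubgroup` — `ρ|_N` semisimple, `N ◁ H`,
  `[H:N]` invertible in `k` ⟹ `ρ` semisimple.
* `Representation.isSemisimpleRepresentation_restrictSubgroup_of_finiteIndex` — `char k = 0`,
  `V` finite-dimensional, `S ≤ G` of finite index, `ρ` semisimple ⟹ `ρ|_S` semisimple.

## References

* L. A. Kurdachenko, J. Otal, I. Ya. Subbotin, *Artinian Modules over Group Rings*, Frontiers in
  Mathematics, Birkhäuser (2007), Ch. 5, Thm. 5.9 (and Cor. 5.6, 5.14).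
  `doi:10.1007/978-3-7643-7765-6` [KurdachenkoOtalSubbotin2007]
* A. H. Clifford, Ann. of Math. (2) 38 (1937), Thm. 1. [Clifford1937]
* C. W. Curtis, I. Reiner, *Representation Theory of Finite Groups and Associative Algebras*
  (1962), §10 (Maschke), (49.2) (Clifford). [CurtisReiner1962]
-/

noncomputable section

open MonoidAlgebra

namespace Literature.RepresentationTheory.Semisimple

namespace Representation

variable {k H V : Type*} [Field k] [Group H] [AddCommGroup V] [Module k V]

/-- Two subrepresentations are complements of each other iff their underlying submodules are
(`⊓`, `⊔`, `⊥`, `⊤` of subrepresentations are computed on submodules). [folklore] -/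
theorem Subrepresentation.isCompl_iff_toSubmodule {σ : _root_.Representation k H V}
    (a b : Subrepresentation σ) : IsCompl a b ↔ IsCompl a.toSubmodule b.toSubmodule := by
  rw [isCompl_iff, isCompl_iff, disjoint_iff, disjoint_iff, codisjoint_iff, codisjoint_iff,
    ← Subrepresentation.toSubmodule_inf, ← Subrepresentation.toSubmodule_sup,
    ← Subrepresentation.toSubmodule_injective.eq_iff (a := a ⊓ b),
    ← Subrepresentation.toSubmodule_injective.eq_iff (a := a ⊔ b)]
  rfl

variable (ρ : _root_.Representation k H V) (N : Subgroup H)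

/-- **Relative Maschke theorem (one subrepresentation).**  Let `N ◁ H` be a normal subgroup of
finite index `[H:N]` invertible in the field `k`, `ρ` a representation of `H` on `V`, and `W` an
`H`-subrepresentation which, as an `N`-subrepresentation of `ρ|_N`, has an `N`-stable complement.
Then `W` has an `H`-stable complement: if `π` is the (`N`-equivariant) projection onto `W` along
the `N`-complement, `ρ(a) π ρ(a)⁻¹` depends only on `aN`, the average
`π̃ = [H:N]⁻¹ Σ_{aN} ρ(a) π ρ(a)⁻¹` is an `H`-equivariant projection of `V` onto `W`, and `ker π̃`
is an `H`-stable complement (Mathlib `LinearMap.isCompl_of_proj`).  Kurdachenko–Otal–Subbotin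
2007, Ch. 5, Thm. 5.9 (there for an `R`-complement and up to the exponent `n = [H:N]`; over a
field with `n` invertible and an `RN`-complement the same computation gives a complement).
[cite: KurdachenkoOtalSubbotin2007, Ch. 5, Theorem 5.9] -/
theorem exists_isCompl_of_exists_isCompl_restrictSubgroup [N.Normal] [N.FiniteIndex]
    (hk : (N.index : k) ≠ 0) (W : Subrepresentation ρ)
    (hW : ∃ W' : Subrepresentation (restrictSubgroup ρ N),
      IsCompl W.toSubmodule W'.toSubmodule) :
    ∃ W'' : Subrepresentation ρ, IsCompl W W'' := by
  classical
  letI : Fintype (H ⧸ N) := Subgroup.fintypeQuotientOfFiniteIndex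
  obtain ⟨W', hc⟩ := hW
  -- the `N`-equivariant projection onto `W` along `W'`
  set π : V →ₗ[k] V := W.toSubmodule.projection W'.toSubmodule hc with hπ
  have hπW : ∀ v, π v ∈ W.toSubmodule := fun v => Submodule.projection_apply_mem hc v
  have hπid : ∀ w ∈ W.toSubmodule, π w = w := fun w hw =>
    Submodule.projection_apply_of_mem_left hc hw
  have hπ0 : ∀ w' ∈ W'.toSubmodule, π w' = 0 := fun w' hw' =>
    Submodule.projection_apply_of_mem_right hc hw'
  have hπN : ∀ n : N, ∀ v, π (ρ n v) = ρ n (π v) := by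
    intro n v
    have hv : v ∈ W.toSubmodule ⊔ W'.toSubmodule := by
      rw [hc.sup_eq_top]; exact Submodule.mem_top
    obtain ⟨w, hw, w', hw', rfl⟩ := Submodule.mem_sup.mp hv
    have hnw : ρ n w ∈ W.toSubmodule := W.apply_mem_toSubmodule n hw
    have hnw' : ρ n w' ∈ W'.toSubmodule := W'.apply_mem_toSubmodule n hw'
    rw [map_add, map_add, hπid _ hnw, hπ0 _ hnw', add_zero, map_add, hπid w hw, hπ0 w' hw',
      add_zero]
  -- `ρ(n) ρ(n)⁻¹ = 1`
  have hinv : ∀ (a : H) (x : V), ρ a (ρ a⁻¹ x) = x := fun a x => by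
    rw [← Module.End.mul_apply, ← map_mul, mul_inv_cancel, map_one, Module.End.one_apply]
  have hinv' : ∀ (a : H) (x : V), ρ a⁻¹ (ρ a x) = x := fun a x => by
    rw [← Module.End.mul_apply, ← map_mul, inv_mul_cancel, map_one, Module.End.one_apply]
  -- the conjugates `c a = ρ(a) π ρ(a)⁻¹` depend only on `aN`
  set c : H → V →ₗ[k] V := fun a => (ρ a) ∘ₗ π ∘ₗ (ρ a⁻¹) with hcdef
  have hc_apply : ∀ a v, c a v = ρ a (π (ρ a⁻¹ v)) := fun a v => rfl
  have hcN : ∀ a b : H, a⁻¹ * b ∈ N → c a = c b := by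
    intro a b hab
    obtain ⟨n, rfl⟩ : ∃ n : N, b = a * (n : H) := ⟨⟨a⁻¹ * b, hab⟩, (mul_inv_cancel_left a b).symm⟩
    ext v
    rw [hc_apply, hc_apply, map_mul, mul_inv_rev, map_mul, Module.End.mul_apply,
      Module.End.mul_apply, ← hπN n, hinv]
  set cbar : H ⧸ N → V →ₗ[k] V :=
    Quotient.lift c fun a b hab => hcN a b (QuotientGroup.leftRel_apply.mp hab) with hcbar_def
  have hcbar : ∀ a : H, cbar (a : H ⧸ N) = c a := fun a => rfl
  -- the averaged projection
  set πt : V →ₗ[k] V := (N.index : k)⁻¹ • ∑ q : H ⧸ N, cbar q with hπt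
  have hπt_apply : ∀ v, πt v = (N.index : k)⁻¹ • ∑ q : H ⧸ N, cbar q v := fun v => by
    simp only [hπt, LinearMap.smul_apply, LinearMap.coe_sum, Finset.sum_apply]
  have hidx : (Fintype.card (H ⧸ N) : k) = N.index := by
    rw [Fintype.card_eq_nat_card]; rfl
  -- (i) image in `W`
  have h1 : ∀ v, πt v ∈ W.toSubmodule := fun v => by
    rw [hπt_apply]
    refine Submodule.smul_mem _ _ (Submodule.sum_mem _ fun q _ => ?_)
    induction q using QuotientGroup.induction_on with
    | H a =>
      rw [hcbar, hc_apply]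
      exact W.apply_mem_toSubmodule a (hπW _)
  -- (ii) identity on `W`
  have h2 : ∀ w ∈ W.toSubmodule, πt w = w := fun w hw => by
    rw [hπt_apply]
    have hq : ∀ q : H ⧸ N, cbar q w = w := fun q => by
      induction q using QuotientGroup.induction_on with
      | H a => rw [hcbar, hc_apply, hπid _ (W.apply_mem_toSubmodule a⁻¹ hw), hinv]
    simp only [hq, Finset.sum_const, Finset.card_univ]
    rw [← Nat.cast_smul_eq_nsmul k, smul_smul, hidx, inv_mul_cancel₀ hk, one_smul]
  -- (iii) `H`-equivariance
  have h3 : ∀ (g : H) (v : V), πt (ρ g v) = ρ g (πt v) := fun g v => by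
    rw [hπt_apply, hπt_apply, map_smul, map_sum]
    congr 1
    rw [show (∑ q : H ⧸ N, cbar q (ρ g v)) = ∑ q : H ⧸ N, cbar (g • q) (ρ g v) from
      (Equiv.sum_comp (MulAction.toPerm g) (fun q => cbar q (ρ g v))).symm]
    refine Finset.sum_congr rfl fun q _ => ?_
    induction q using QuotientGroup.induction_on with
    | H a =>
      rw [MulAction.Quotient.smul_mk, smul_eq_mul, hcbar, hcbar, hc_apply, hc_apply, map_mul,
        mul_inv_rev, map_mul, Module.End.mul_apply, Module.End.mul_apply, hinv']
  -- conclude: `ker π̃` is an `H`-stable complement of `W`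
  set f : V →ₗ[k] W.toSubmodule := LinearMap.codRestrict W.toSubmodule πt h1 with hf
  have hfid : ∀ x : W.toSubmodule, f x = x := fun x => Subtype.ext (h2 x x.2)
  refine ⟨⟨LinearMap.ker f, fun g v hv => ?_⟩,
    (Subrepresentation.isCompl_iff_toSubmodule _ _).mpr (LinearMap.isCompl_of_proj hfid)⟩
  rw [LinearMap.mem_ker] at hv ⊢
  apply Subtype.ext
  change πt (ρ g v) = 0
  rw [h3, show πt v = 0 from congrArg Subtype.val hv, map_zero]

/-- **Relative Maschke theorem.**  Let `N ◁ H` be a normal subgroup of finite index `[H:N]`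
invertible in the field `k` and `ρ` a representation of `H` on a `k`-vector space `V`.  If the
restriction `ρ|_N` is semisimple (every `N`-subrepresentation has an `N`-stable complement,
Mathlib `Representation.IsSemisimpleRepresentation`), then `ρ` is semisimple
(`exists_isCompl_of_exists_isCompl_restrictSubgroup` applied to every `H`-subrepresentation, which
is in particular an `N`-subrepresentation).  For `N = 1` this is Maschke's theorem.
Kurdachenko–Otal–Subbotin 2007, Ch. 5, Thm. 5.9 with Cor. 5.14.
[cite: KurdachenkoOtalSubbotin2007, Ch. 5, Theorem 5.9 and Corollary 5.14] -/
theorem isSemisimpleRepresentation_of_restrictSubgroup [N.Normal] [N.FiniteIndex]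
    (hk : (N.index : k) ≠ 0) (h : (restrictSubgroup ρ N).IsSemisimpleRepresentation) :
    ρ.IsSemisimpleRepresentation := by
  refine ⟨fun W => ?_⟩
  obtain ⟨W', hW'⟩ := h.exists_isCompl
    (⟨W.toSubmodule, fun n _ hv => W.apply_mem_toSubmodule (n : H) hv⟩ :
      Subrepresentation (restrictSubgroup ρ N))
  exact exists_isCompl_of_exists_isCompl_restrictSubgroup ρ N hk W
    ⟨W', (Subrepresentation.isCompl_iff_toSubmodule _ _).mp hW'⟩

/-- **Restriction to a subgroup of finite index preserves semisimplicity (characteristic `0`).**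
Let `k` be a field of characteristic `0`, `ρ` a semisimple representation of a group `G` on a
finite-dimensional `k`-vector space, and `S ≤ G` a subgroup of finite index.  Then `ρ|_S` is
semisimple: the normal core `N = ⋂_g gSg⁻¹ ◁ G` has finite index and `N ≤ S`; `ρ|_N` is
semisimple by Clifford's theorem (`isSemisimpleRepresentation_restrictSubgroup`), and `N ◁ S` has
finite index, so `ρ|_S` is semisimple by the relative Maschke theorem
(`isSemisimpleRepresentation_of_restrictSubgroup`).  Kurdachenko–Otal–Subbotin 2007, Ch. 5,
Cor. 5.6 and Thm. 5.9; Clifford 1937, Thm. 1.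
[cite: KurdachenkoOtalSubbotin2007, Ch. 5, Corollary 5.6 and Theorem 5.9] -/
theorem isSemisimpleRepresentation_restrictSubgroup_of_finiteIndex [CharZero k]
    [FiniteDimensional k V] {G : Type*} [Group G] (σ : _root_.Representation k G V)
    (S : Subgroup G) [S.FiniteIndex] (h : σ.IsSemisimpleRepresentation) :
    (restrictSubgroup σ S).IsSemisimpleRepresentation := by
  set N : Subgroup G := S.normalCore with hN
  haveI : N.Normal := Subgroup.normalCore_normal S
  -- `ρ|_N` is semisimple (Clifford)
  have hNss : (restrictSubgroup σ N).IsSemisimpleRepresentation :=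
    isSemisimpleRepresentation_restrictSubgroup σ N h
  -- `N ◁ S` of finite index
  set N' : Subgroup S := N.subgroupOf S with hN'
  haveI : N'.Normal := Subgroup.Normal.subgroupOf inferInstance S
  haveI : N'.FiniteIndex := Subgroup.instFiniteIndex_subgroupOf N S
  have hk : (N'.index : k) ≠ 0 := Nat.cast_ne_zero.mpr Subgroup.FiniteIndex.index_ne_zero
  refine ⟨fun W => ?_⟩
  -- `W` is an `N`-subrepresentation of `ρ|_N`; take an `N`-stable complement
  obtain ⟨W', hW'⟩ := hNss.exists_isCompl
    (⟨W.toSubmodule, fun n _ hv => W.apply_mem_toSubmodule ⟨(n : G), Subgroup.normalCore_le S n.2⟩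
      hv⟩ : Subrepresentation (restrictSubgroup σ N))
  -- and view it as an `N'`-stable complement for `(ρ|_S)|_{N'}`
  exact exists_isCompl_of_exists_isCompl_restrictSubgroup (restrictSubgroup σ S) N' hk W
    ⟨⟨W'.toSubmodule, fun n' _ hv =>
        W'.apply_mem_toSubmodule ⟨((n' : S) : G), Subgroup.mem_subgroupOf.mp n'.2⟩ hv⟩,
      (Subrepresentation.isCompl_iff_toSubmodule _ _).mp hW'⟩

end Representation

end Literature.RepresentationTheory.Semisimple
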